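import Literature.MathematicalPhysics.QuantumFieldTheory.Balaban1983to89.B9Thm314
import Literature.MathematicalPhysics.QuantumFieldTheory.Balaban1983to89.B9SectCWalkTermsAllNorms
import Literature.MathematicalPhysics.QuantumFieldTheory.Balaban1983to89.B9FromB6ModelSignsOn

/-!
# `Balaban1983to89.B9Thm314Whole` — [B9] Theorem 3.14 (pp. 426–427) AS THE WHOLE PRINTED LEAVES `B9Thm314.Thm314LocalPrinted`
# (sup + L² + Hölder entries with the additional factor, y, y′ ∈ Ω^{(k)}) and `B9.Thm314Printed` (sup entries, unrestricted):
# a glue module over `B9Thm314` (the printed proof from named leaves, sup entries) and the typer's all-norms per-walk blocks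

T. Bałaban, *Propagators for lattice gauge theories in a background field*, Commun. Math. Phys. **99** (1985) 389–434
[`Balaban1985BackgroundPropagators`, "B9"].

statement-level skeleton of published theorems with citation tags; proofs where landed; nothing here is a claim about the Yang–Mills mass gap

THE PRINTED LOCI (verbatim).  p. 426, Theorem 3.14: *"If we take a pair of operators constructed for the two sequences {Ω_j}, {Ω′_j},
then their difference satisfies all the inequalities characteristic for operators of the considered type, with the additional factor
exp(−δ₀d(y, y′, Ω)), d(y, y′, Ω) = inf_{y₁∈Ωᶜ∩T^{(k)}}(|y − y₁| + |y₁ − y′|) (3.154) on the right-hand sides."*; p. 427 (the whole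
printed proof): *"This theorem can be proved in exactly the same way as the corresponding property in the theorem of [2]. We take
random walk expansions for both operators, and in the difference all terms for walks with localizations contained in Ω are cancelled.
Remaining terms correspond to walks of the general type (3.107), for which at least one localization X_i intersects Ωᶜ. Then the
exponential factor in (3.108) gives the factor (3.154) (after adjusting a definition of δ₀)."*; p. 410: *"Similar estimates hold for
the other norms."*; p. 416 (3.108): *"and the corresponding inequalities for norms on the left-hand sides of (3.42)–(3.47)."*

THE POINT.  The N06 certificate carries Theorem 3.14 twice: `t314 : B9.Thm314Printed c35 geo bg Kdiff dOmega` (sup entries, no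
localisation restriction; N06-ASSIGNMENT row 22) and `t314loc : B9Thm314.Thm314LocalPrinted c35 geo bg Kdiff OmK dOmega` (sup + L² +
Hölder entries for y, y′ ∈ Ω^{(k)}; row 23).  Seat n06-a (`B9Thm314`) kernel-checked the printed proof for the SUP entries from three
named leaves (cancellation leaf `DiffExpansionPrinted`, geometry `LocData`/`LocData.Laws` of (3.93)/(3.154), summation-with-factor leaf
`RWSumFactorYields`) under an M-uniform diameter bound (`thm314Printed_of_leaves`); the typer (`B9SectCWalkTermsAllNorms`) typed the
per-walk blocks of (3.108) for ALL local norms.  No theorem concluded the L² and Hölder parts of `Thm314LocalPrinted`.  THIS FILE: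
* §1 schemas `DiffExpansionAllNorms` (CANCELLATION LEAF, all norms, over the typer's per-walk blocks), `TermSupL2F`/`TermHolderF` (per-walk
  blocks with step power `walkFactorS`, restriction `P`, walk-independent extra factor `F`), `RWSumFactorYieldsSupL2`/`…Holder` (SUMMATION
  LEAVES with factor, by reference as `B9.RWSumsYieldIneqs`, GAPS G-B9-07), `diffExpansionPrinted_of_allNorms` (⊇ n06-a's sup leaf).
* §2 kernel-checked: `le_split_walkFactor` (route (i) of `B9Thm314`, any norm), `termSupL2F_of_termIneq`/`termHolderF_of_termIneq`
  (cancellation leaf + geometry ⇒ the summation leaves' inputs), `ineqSupF_weaken`/`ineqL2F_weaken`/`ineqHolderF_weaken`.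
* §3 ★ `thm314LocalPrinted_of_leaves` (ROW 23), `thm314SupOn_of_leaves`, ★ `thm314Printed_of_leaves_allNorms` (ROW 22 from the SAME
  cancellation leaf with the sup/L² summation leaf unrestricted — on this route the restriction is idle, so row 22 needs neither (β) nor
  (γ) of `B9Thm314Unrestricted`), `thm314_pair_of_leaves`.
* companion `B9Thm314WholeParts`: the local leaf assembled from a sup part (e.g. the resolvent route's M-uniform
  `B9Thm314SupReading.thm314SupOn_of_hasMajorantHom`), an L² part and a Hölder part, and the projections back.

HONEST SCOPE — TYPED-LEAF FLAG T314 PART (ii) STANDS.  Exactly as in n06-a's `thm314Printed_of_leaves`, the M-UNIFORM constants of the two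
leaf fields come out of the printed sketch ONLY under the displayed hypothesis `hr` (every localisation domain meeting Ωᶜ lies within |·|-distance
r₀ of Ωᶜ ∩ T^{(k)}, r₀ INDEPENDENT of M), which FAILS for the domains of Sect. C (diameters of order M): the sketch itself delivers an
M-dependent constant e^{O(δ₀M)} or an M-dependent rate ([2]'s "δ₀ depending on d, M") — GAPS G-B9-08 / G-B9-19 / G-pv05-1,
`B9Thm314.thm314Dep_of_leaves_exp/_steps`; M-uniform sup entries come from the RESOLVENT route (`B9Thm314SupReading`), which the companion's
assembly combines with the other parts.  The leaves are HYPOTHESES of printed shape, never discharged here: the summation leaves are dischargeable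
at a pin only when `Converges U` ENTAILS that the difference family's quantities are bounded by the absolutely convergent sums of the walk terms'
quantities with the walk counting of (3.91) (arithmetic: `B9Thm37Sum.walkSum_le`); the cancellation leaf requires the local factors of the two
sequences to coincide inside Ω (G-B9-08).  Signs enter through `B9FromB6ModelSignsOn.ModelSignsOn` (theorems at the record's genuine norms) and
`d(·,·,Ω) ≥ 0`.  Value: kernel-checked bookkeeping, NOT a node discharge, NOT summit progress; one finite lattice programme; nothing continuum,
nothing about the mass gap.  Cell `pub-ymgap` (D-0062), node N06 [B9], N06-ASSIGNMENT v1 rows 22–23, seat `pub-ymgap-dag-n06-m`, 2026-08-26.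
-/

namespace Literature.MathematicalPhysics.QuantumFieldTheory.Balaban1983to89.B9Thm314Whole

open B9 B9Thm314 B9SectCWalkTermsAllNorms B9FromB6ModelSignsOn

/-! ## §1 The leaves of the printed proof in all local norms -/

section Schemas

variable {g : Geometry} {B : Backgrounds}

/-- **PER-WALK SUP AND L² BLOCKS WITH AN EXTRA FACTOR**: for walks ω from y to y′ with `P y`, `P y′`, the ω-term's four sup quantities
(3.42) and six L² quantities (3.46) (`termK ω`) obey the Theorem-3.1 shapes with the walk factor `walkFactorS A c M s δ |ω| d(ω,y,y′)`
= A(cM^{−s})^{|ω|}e^{−½δd(ω,y,y′)} times a walk-independent factor `F y y′` — the input shape of the summation leaf (n06-a's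
`RWSumFactorYields`, all sup and L² entries). [cite: Balaban1985BackgroundPropagators, (3.108) p.416 + (3.42) p.397 + (3.46) p.398 + (3.154) p.427] -/
def TermSupL2F (E : RWExpansion g B) (termK : E.Walk → KernelFamily g B) (A c s δ : ℝ) (P : g.Site → Prop)
    (F : g.Site → g.Site → ℝ) (U : B.Cfg) : Prop :=
  (∀ (ω : E.Walk) (n : Fin 4) (lam : g.Loc) (y y' : g.Site), E.first ω y → E.last ω y' → P y → P y' → g.suppIn lam y' →
      (termK ω).e n U lam y ≤
        pref4 (g.len y) n * walkFactorS A c g.M s δ (E.wlen ω) (E.wdist ω y y') * F y y' * g.supNorm lam) ∧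
  (∀ (ω : E.Walk) (n : Fin 6) (lam : g.Loc) (h : g.Cut) (y y' : g.Site), E.first ω y → E.last ω y' → P y → P y' →
      g.cutIn h y → g.suppIn lam y' →
      (termK ω).l2 n U lam h ≤
        pref6 (g.len y) n * g.cutSup h * walkFactorS A c g.M s δ (E.wlen ω) (E.wdist ω y y') * F y y' * g.l2Norm lam)

/-- **PER-WALK HÖLDER BLOCKS WITH AN EXTRA FACTOR**: the ω-term's Hölder quantities (3.43)–(3.45) (`h1`, `e4`, `h2`) obey the
Theorem-3.1 shapes with the walk factors `walkFactorS (B₀(β)) …`, `walkFactorS (B′₀(ε)) …`, `walkFactorS (B′₀(ε,β)) …` (the β- and ε-dependent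
constants in the walk factor's O(1)) times the walk-independent factor `F y y′`, for y, y′ with `P y`, `P y′` (supports in the small
cubes, as `B9Thm314.IneqHolderF`). [cite: Balaban1985BackgroundPropagators, (3.108) p.416 + (3.43)–(3.45) p.398 + (3.154) p.427] -/
def TermHolderF (E : RWExpansion g B) (termK : E.Walk → KernelFamily g B) (c s δ : ℝ) (Bβ Bε : ℝ → ℝ)
    (Bεβ : ℝ → ℝ → ℝ) (P : g.Site → Prop) (F : g.Site → g.Site → ℝ) (U : B.Cfg) : Prop :=
  (∀ (ω : E.Walk) (β : ℝ) (lam : g.Loc) (ζ : g.Cut) (y y' : g.Site), 0 ≤ β → β < 1 → E.first ω y → E.last ω y' →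
      P y → P y' → g.cutIn ζ y → g.suppIn lam y' →
      (termK ω).h1 U lam β ζ ≤ (g.len y) ^ (1 - β) * g.cutH β ζ *
        walkFactorS (Bβ β) c g.M s δ (E.wlen ω) (E.wdist ω y y') * F y y' * g.supNorm lam) ∧
  (∀ (ω : E.Walk) (ε : ℝ) (lam : g.Loc) (y y' : g.Site), 0 < ε → ε ≤ 1 → E.first ω y → E.last ω y' → P y → P y' →
      g.suppIn lam y' →
      (termK ω).e4 U lam y ≤
        walkFactorS (Bε ε) c g.M s δ (E.wlen ω) (E.wdist ω y y') * F y y' * (g.holder ε lam + g.supNorm lam)) ∧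
  (∀ (ω : E.Walk) (ε β : ℝ) (lam : g.Loc) (ζ : g.Cut) (y y' : g.Site), 0 < ε → ε ≤ 1 → 0 ≤ β → β < 1 →
      E.first ω y → E.last ω y' → P y → P y' → g.cutIn ζ y → g.suppIn lam y' →
      (termK ω).h2 U lam β ζ ≤ (g.len y) ^ (-β) * g.cutH β ζ *
        walkFactorS (Bεβ ε β) c g.M s δ (E.wlen ω) (E.wdist ω y y') * F y y' * (g.holder (β + ε) lam + g.supNorm lam))

end Schemas

section Leaves

variable {I : Type}

/-- **CANCELLATION LEAF, ALL LOCAL NORMS** (p. 427: *"We take random walk expansions for both operators, and in the difference all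
terms for walks with localizations contained in Ω are cancelled. Remaining terms correspond to walks of the general type (3.107), for
which at least one localization X_i intersects Ωᶜ"*; p. 416: (3.108) *"and the corresponding inequalities for norms on the left-hand
sides of (3.42)–(3.47)"*): the difference operator of member i is represented by a CONVERGENT expansion `Ediff i` every walk of which
touches Ωᶜ (`Touches`), whose ω-terms — seen through their own quantities `termK i ω` — obey the per-walk blocks of the typer
(`B9SectCWalkTermsAllNorms.TermIneq342_346`, `TermIneq343_345`: (3.108) in the sup, L² and Hölder norms, Hölder constants ≥ 0),
constants depending on d, L only, for M ≥ M₂, Mα₀ ≤ a₀, U in the class (3.35).  n06-a's `DiffExpansionPrinted` is its sup-entry-0 part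
(`diffExpansionPrinted_of_allNorms`).  A hypothesis, never discharged here (located: the local factors of the two sequences must coincide
inside Ω, G-B9-08). [cite: Balaban1985BackgroundPropagators, Thm 3.14 proof p.427 + Thm 3.10 (3.107)–(3.108) pp.415–416] -/
def DiffExpansionAllNorms (c35 : ℝ) (geo : I → Geometry) (bg : I → Backgrounds)
    (Ediff : ∀ i, RWExpansion (geo i) (bg i)) (termK : ∀ i, (Ediff i).Walk → KernelFamily (geo i) (bg i))
    (Touches : ∀ i, (Ediff i).Walk → Prop) : Prop :=
  ∃ M₂ a₀ δ₀ C c : ℝ, ∃ Bβ Bε : ℝ → ℝ, ∃ Bεβ : ℝ → ℝ → ℝ,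
    0 < M₂ ∧ 0 < a₀ ∧ 0 < δ₀ ∧ 0 < C ∧ 0 < c ∧ (∀ β, 0 ≤ Bβ β) ∧ (∀ ε, 0 ≤ Bε ε) ∧ (∀ ε β, 0 ≤ Bεβ ε β) ∧
    ∀ i : I, M₂ ≤ (geo i).M → ∀ α₀ : ℝ, 0 < α₀ → (geo i).M * α₀ ≤ a₀ →
      ∀ U : (bg i).Cfg, (bg i).Reg335 c35 α₀ U →
        (Ediff i).Converges U ∧ (∀ ω : (Ediff i).Walk, Touches i ω) ∧
        TermIneq342_346 (Ediff i) (termK i) C c δ₀ U ∧ TermIneq343_345 (Ediff i) (termK i) c δ₀ Bβ Bε Bεβ U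

/-- **SUMMATION LEAF WITH FACTOR, SUP AND L² ENTRIES** (the Sect. C summation by reference — p. 409 *"from the bound (3.89) and Lemma
2.1 … exactly the same as in proofs of Proposition 1.2 [3] and Proposition 2.2 [4]"*, p. 416 *"From (3.108) it follows that the
expansion (3.107) is convergent in all norms"* — GAPS G-B9-07, as `B9.RWSumsYieldIneqs` and n06-a's `RWSumFactorYields`): if the
expansion converges at U and its terms obey `TermSupL2F` with step power s > 0, rate δ, constant A ≥ 0 and a walk-independent factor
F ≥ 0 on the restriction `P`, then for M ≥ M₃(c, s, δ) the family `K i`'s sup and L² quantities obey (3.42)/(3.46) with constant A·B₁, rate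
δ₁ and the SAME factor F (`IneqSupF`, `IneqL2F`).  A hypothesis; dischargeable at a pin whose `Converges U` entails that `K i`'s
quantities are bounded by the sums of the terms' quantities, with the walk counting of (3.91). [cite: Balaban1985BackgroundPropagators, Thm 3.7 proof p.409 + Thm 3.10 proof p.416 + (3.91) p.409] -/
def RWSumFactorYieldsSupL2 (geo : I → Geometry) (bg : I → Backgrounds) (E : ∀ i, RWExpansion (geo i) (bg i))
    (termK : ∀ i, (E i).Walk → KernelFamily (geo i) (bg i)) (K : ∀ i, KernelFamily (geo i) (bg i))
    (P : ∀ i, (geo i).Site → Prop) : Prop :=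
  ∀ c s δ : ℝ, 0 < c → 0 < s → 0 < δ →
    ∃ M₃ B₁ δ₁ : ℝ, 0 < M₃ ∧ 0 < B₁ ∧ 0 < δ₁ ∧
      ∀ i : I, M₃ ≤ (geo i).M → ∀ (U : (bg i).Cfg) (A : ℝ) (F : (geo i).Site → (geo i).Site → ℝ),
        0 ≤ A → (∀ y y', 0 ≤ F y y') → (E i).Converges U → TermSupL2F (E i) (termK i) A c s δ (P i) F U →
        IneqSupF (K i) (A * B₁) δ₁ (P i) F U ∧ IneqL2F (K i) (A * B₁) δ₁ (P i) F U

/-- **SUMMATION LEAF WITH FACTOR, HÖLDER ENTRIES** (the same printed sentence for the norms (3.43)–(3.45)): from `TermHolderF` with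
nonnegative constant functions B₀(β), B′₀(ε), B′₀(ε,β) and a factor F ≥ 0, for M ≥ M₃(c, s, δ), the family `K i`'s Hölder quantities obey
(3.43)–(3.45) with the constants multiplied by B₁, rate δ₁ and the same factor (`IneqHolderF`).  A hypothesis (G-B9-07), dischargeable
under the same reading of `Converges`. [cite: Balaban1985BackgroundPropagators, Cor. 3.8 p.410 («Similar estimates hold for the other norms») + Thm 3.10 proof p.416] -/
def RWSumFactorYieldsHolder (geo : I → Geometry) (bg : I → Backgrounds) (E : ∀ i, RWExpansion (geo i) (bg i))
    (termK : ∀ i, (E i).Walk → KernelFamily (geo i) (bg i)) (K : ∀ i, KernelFamily (geo i) (bg i))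
    (P : ∀ i, (geo i).Site → Prop) : Prop :=
  ∀ c s δ : ℝ, 0 < c → 0 < s → 0 < δ →
    ∃ M₃ B₁ δ₁ : ℝ, 0 < M₃ ∧ 0 < B₁ ∧ 0 < δ₁ ∧
      ∀ i : I, M₃ ≤ (geo i).M → ∀ (U : (bg i).Cfg) (Bβ Bε : ℝ → ℝ) (Bεβ : ℝ → ℝ → ℝ)
        (F : (geo i).Site → (geo i).Site → ℝ),
        (∀ β, 0 ≤ Bβ β) → (∀ ε, 0 ≤ Bε ε) → (∀ ε β, 0 ≤ Bεβ ε β) → (∀ y y', 0 ≤ F y y') → (E i).Converges U →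
        TermHolderF (E i) (termK i) c s δ Bβ Bε Bεβ (P i) F U →
        IneqHolderF (K i) (fun β => Bβ β * B₁) (fun ε => Bε ε * B₁) (fun ε β => Bεβ ε β * B₁) δ₁ (P i) F U

/-- **The all-norms cancellation leaf contains n06-a's sup leaf `B9Thm314.DiffExpansionPrinted`** when the expansion carrier's `term` IS
entry 0 of the walk-indexed family (the reading `hterm`, as `B9SectCWalkTermsAllNorms.thm310Printed_of_allNorms`; (Lʲη)² = `pref4 _ 0`).
[cite: Balaban1985BackgroundPropagators, Thm 3.14 proof p.427 + (3.108) p.416 (bookkeeping)] -/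
theorem diffExpansionPrinted_of_allNorms {c35 : ℝ} {geo : I → Geometry} {bg : I → Backgrounds}
    {Ediff : ∀ i, RWExpansion (geo i) (bg i)} {termK : ∀ i, (Ediff i).Walk → KernelFamily (geo i) (bg i)}
    {Touches : ∀ i, (Ediff i).Walk → Prop}
    (hterm : ∀ (i : I) (U : (bg i).Cfg) (ω : (Ediff i).Walk) (lam : (geo i).Loc) (y : (geo i).Site),
      (Ediff i).term U ω lam y = (termK i ω).e 0 U lam y)
    (h : DiffExpansionAllNorms c35 geo bg Ediff termK Touches) : DiffExpansionPrinted c35 geo bg Ediff Touches := by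
  obtain ⟨M₂, a₀, δ₀, C, c, Bβ, Bε, Bεβ, hM, ha, hδ, hC, hc, -, -, -, H⟩ := h
  refine ⟨M₂, a₀, δ₀, C, c, hM, ha, hδ, hC, hc, fun i hMi α₀ hα hMa U hU => ?_⟩
  obtain ⟨hconv, htouch, h42, -⟩ := H i hMi α₀ hα hMa U hU
  refine ⟨hconv, htouch, fun ω lam y y' hf hl hs => ?_⟩
  rw [hterm, ← pref4_zero]
  exact h42.1 ω 0 lam y y' hf hl hs

end Leaves

/-! ## §2 Kernel-checked: the split of the walk factor in every norm; the weakenings -/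

section Split

variable {g : Geometry} {B : Backgrounds}

/-- **ROUTE (i) FOR A TERM BOUND OF ANY NORM** (*"the exponential factor in (3.108) gives the factor (3.154) (after adjusting a definition
of δ₀)"*): a bound q ≤ p·walkFactor(C, c, M, δ₀, |ω|, d(ω,y,y′))·m with p, m ≥ 0 (the norm's prefactor and the argument's size) and
d(y, y′, Ω) ≤ d(ω, y, y′) + 2r give q ≤ p·walkFactorS(Ce^{½δ₀r}, c, M, 1, ½δ₀, …)·e^{−¼δ₀d(y,y′,Ω)}·m (`B9Thm314.walkFactorS_split_exp`).
[cite: Balaban1985BackgroundPropagators, Thm 3.14 proof p.427] -/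
theorem le_split_walkFactor {q p m C c M δ₀ r dω dΩ : ℝ} {n : ℕ} (h : q ≤ p * walkFactor C c M δ₀ n dω * m)
    (hp : 0 ≤ p) (hm : 0 ≤ m) (hC : 0 ≤ C) (hc : 0 ≤ c) (hM : 0 < M) (hδ₀ : 0 ≤ δ₀) (hΩ : dΩ ≤ dω + 2 * r) :
    q ≤ p * walkFactorS (C * Real.exp (δ₀ / 2 * r)) c M 1 (δ₀ / 2) n dω * Real.exp (-(δ₀ / 2 / 2 * dΩ)) * m := by
  rw [walkFactor_eq_walkFactorS hM] at h
  have hs := walkFactorS_split_exp (s := 1) (n := n) (dω := dω) hC hc hM hδ₀ hΩ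
  calc q ≤ p * walkFactorS C c M 1 δ₀ n dω * m := h
    _ ≤ p * (walkFactorS (C * Real.exp (δ₀ / 2 * r)) c M 1 (δ₀ / 2) n dω * Real.exp (-(δ₀ / 2 / 2 * dΩ))) * m :=
        mul_le_mul_of_nonneg_right (mul_le_mul_of_nonneg_left hs hp) hm
    _ = _ := by ring

variable {E : RWExpansion g B} {termK : E.Walk → KernelFamily g B} {dOmega : g.Site → g.Site → ℝ} {U : B.Cfg}
  {Ps : g.Loc → Prop}

/-- **THE CANCELLATION LEAF'S SUP/L² BLOCKS ⇒ THE SUMMATION LEAF'S INPUT**: with the geometry of (3.93)/(3.154) (`LocData.Laws`, diameter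
bound φ of the touching domains) and every walk touching Ωᶜ, the per-walk blocks `TermIneq342_346 E termK C c δ₀ U` give
`TermSupL2F E termK (Ce^{½δ₀φ}) c 1 (½δ₀) P (e^{−¼δ₀d(·,·,Ω)}) U` for every restriction `P` — `B9Thm314.dOmega_le_wdist_add` + `le_split_walkFactor`,
entry by entry (signs of the prefactors from `ModelSignsOn`). [cite: Balaban1985BackgroundPropagators, Thm 3.14 proof p.427 + (3.93) p.410] -/
theorem termSupL2F_of_termIneq (D : LocData g B E) (L : D.Laws dOmega) {φ : ℝ} (hφ : D.diam ≤ φ) (S : ModelSignsOn g Ps)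
    {C c δ₀ : ℝ} (hC : 0 ≤ C) (hc : 0 ≤ c) (hM : 0 < g.M) (hδ₀ : 0 ≤ δ₀) (htouch : ∀ ω, D.Touches ω)
    (h : TermIneq342_346 E termK C c δ₀ U) (P : g.Site → Prop) :
    TermSupL2F E termK (C * Real.exp (δ₀ / 2 * φ)) c 1 (δ₀ / 2) P (fun y y' => Real.exp (-(δ₀ / 2 / 2 * dOmega y y'))) U := by
  have hgeo : ∀ {ω y y'}, E.first ω y → E.last ω y' → dOmega y y' ≤ E.wdist ω y y' + 2 * φ := fun hy hy' => by
    have := dOmega_le_wdist_add D L hy hy' (htouch _)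
    linarith
  refine ⟨fun ω n lam y y' hf hl _ _ hs => ?_, fun ω n lam hc' y y' hf hl _ _ hcut hs => ?_⟩
  · exact le_split_walkFactor (h.1 ω n lam y y' hf hl hs) (B9FromB6.pref4_nonneg (S.len_nonneg y) n) (S.supNorm_nonneg lam)
      hC hc hM hδ₀ (hgeo hf hl)
  · exact le_split_walkFactor (h.2 ω n lam hc' y y' hf hl hcut hs)
      (mul_nonneg (B9FromB6.pref6_nonneg (S.len_nonneg y) n) (S.cutSup_nonneg hc')) (S.l2Norm_nonneg lam) hC hc hM hδ₀
      (hgeo hf hl)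

/-- **THE CANCELLATION LEAF'S HÖLDER BLOCKS ⇒ THE HÖLDER SUMMATION LEAF'S INPUT**: the same split for (3.43)–(3.45), with the constants
B₀(β)e^{½δ₀φ}, B′₀(ε)e^{½δ₀φ}, B′₀(ε,β)e^{½δ₀φ}; the typer's blocks are stated for the large-cube supports Δ̃ ((3.44)–(3.45) as printed), the
summation input for the small cubes Δ (`g.suppInT_of_suppIn`, `g.cutInT_of_cutIn`). [cite: Balaban1985BackgroundPropagators, Thm 3.14 proof p.427 + (3.43)–(3.45) p.398] -/
theorem termHolderF_of_termIneq (D : LocData g B E) (L : D.Laws dOmega) {φ : ℝ} (hφ : D.diam ≤ φ) (S : ModelSignsOn g Ps)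
    {c δ₀ : ℝ} {Bβ Bε : ℝ → ℝ} {Bεβ : ℝ → ℝ → ℝ} (hBβ : ∀ β, 0 ≤ Bβ β) (hBε : ∀ ε, 0 ≤ Bε ε) (hBεβ : ∀ ε β, 0 ≤ Bεβ ε β)
    (hc : 0 ≤ c) (hM : 0 < g.M) (hδ₀ : 0 ≤ δ₀) (htouch : ∀ ω, D.Touches ω) (h : TermIneq343_345 E termK c δ₀ Bβ Bε Bεβ U)
    (P : g.Site → Prop) :
    TermHolderF E termK c 1 (δ₀ / 2) (fun β => Bβ β * Real.exp (δ₀ / 2 * φ)) (fun ε => Bε ε * Real.exp (δ₀ / 2 * φ))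
      (fun ε β => Bεβ ε β * Real.exp (δ₀ / 2 * φ)) P (fun y y' => Real.exp (-(δ₀ / 2 / 2 * dOmega y y'))) U := by
  have hgeo : ∀ {ω y y'}, E.first ω y → E.last ω y' → dOmega y y' ≤ E.wdist ω y y' + 2 * φ := fun hy hy' => by
    have := dOmega_le_wdist_add D L hy hy' (htouch _)
    linarith
  have hhs (ε : ℝ) (lam : g.Loc) : 0 ≤ g.holder ε lam + g.supNorm lam := add_nonneg (S.holder_nonneg ε lam) (S.supNorm_nonneg lam)
  refine ⟨fun ω β lam ζ y y' hβ hβ1 hf hl _ _ hcut hs => ?_, fun ω ε lam y y' hε hε1 hf hl _ _ hs => ?_,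
    fun ω ε β lam ζ y y' hε hε1 hβ hβ1 hf hl _ _ hcut hs => ?_⟩
  · exact le_split_walkFactor (h.1 ω β lam ζ y y' hβ hβ1 hf hl (g.cutInT_of_cutIn ζ y hcut) hs)
      (mul_nonneg (Real.rpow_nonneg (S.len_nonneg y) _) (S.cutH_nonneg β ζ)) (S.supNorm_nonneg lam) (hBβ β) hc hM hδ₀
      (hgeo hf hl)
  · have h0 := h.2.1 ω ε lam y y' hε hε1 hf hl (g.suppInT_of_suppIn lam y' hs)
    rw [← one_mul (walkFactor _ _ _ _ _ _)] at h0
    have := le_split_walkFactor h0 zero_le_one (hhs ε lam) (hBε ε) hc hM hδ₀ (hgeo hf hl)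
    rwa [one_mul] at this
  · exact le_split_walkFactor (h.2.2 ω ε β lam ζ y y' hε hε1 hβ hβ1 hf hl (g.cutInT_of_cutIn ζ y hcut)
      (g.suppInT_of_suppIn lam y' hs)) (mul_nonneg (Real.rpow_nonneg (S.len_nonneg y) _) (S.cutH_nonneg β ζ))
      (hhs (β + ε) lam) (hBεβ ε β) hc hM hδ₀ (hgeo hf hl)

end Split

section Weaken

variable {g : Geometry} {B : Backgrounds} {K : KernelFamily g B} {P : g.Site → Prop} {F F' : g.Site → g.Site → ℝ} {U : B.Cfg}
  {Ps : g.Loc → Prop}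

/-- Weakening of a bound q ≤ b·p·e^{−δt}·f·m in the constant (b ≤ b′), the rate (δ′ ≤ δ, t ≥ 0) and the factor (f ≤ f′), for
p, f, m ≥ 0. [folklore] -/
private theorem mono5 {q b b' p δ δ' t f f' m : ℝ} (h : q ≤ b * p * Real.exp (-(δ * t)) * f * m) (hb : b ≤ b') (hb' : 0 ≤ b')
    (hp : 0 ≤ p) (hδ : δ' ≤ δ) (ht : 0 ≤ t) (hf : f ≤ f') (hf0 : 0 ≤ f) (hm : 0 ≤ m) :
    q ≤ b' * p * Real.exp (-(δ' * t)) * f' * m := by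
  refine h.trans (mul_le_mul_of_nonneg_right ?_ hm)
  have he : Real.exp (-(δ * t)) ≤ Real.exp (-(δ' * t)) :=
    Real.exp_le_exp.2 (neg_le_neg (mul_le_mul_of_nonneg_right hδ ht))
  have h1 : b * p * Real.exp (-(δ * t)) ≤ b' * p * Real.exp (-(δ' * t)) :=
    mul_le_mul (mul_le_mul_of_nonneg_right hb hp) he (Real.exp_nonneg _) (mul_nonneg hb' hp)
  exact mul_le_mul h1 hf hf0 (mul_nonneg (mul_nonneg hb' hp) (Real.exp_nonneg _))

/-- **Weakening the sup block with factor** («after adjusting a definition of δ₀»): constant up, rate down, factor up (d ≥ 0, the model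
signs). [cite: Balaban1985BackgroundPropagators, Thm 3.14 proof p.427 (bookkeeping)] -/
theorem ineqSupF_weaken (S : ModelSignsOn g Ps) {B₀ B₀' δ δ' : ℝ} (h : IneqSupF K B₀ δ P F U) (hB : B₀ ≤ B₀') (hB' : 0 ≤ B₀')
    (hδ : δ' ≤ δ) (hF : ∀ y y', F y y' ≤ F' y y') (hF0 : ∀ y y', 0 ≤ F y y') : IneqSupF K B₀' δ' P F' U :=
  fun n lam y y' hy hy' hs => mono5 (h n lam y y' hy hy' hs) hB hB' (B9FromB6.pref4_nonneg (S.len_nonneg y) n) hδ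
    (S.dist_nonneg y y') (hF y y') (hF0 y y') (S.supNorm_nonneg lam)

/-- **Weakening the L² block with factor.** [cite: Balaban1985BackgroundPropagators, Thm 3.14 proof p.427 (bookkeeping)] -/
theorem ineqL2F_weaken (S : ModelSignsOn g Ps) {B₀ B₀' δ δ' : ℝ} (h : IneqL2F K B₀ δ P F U) (hB : B₀ ≤ B₀') (hB' : 0 ≤ B₀')
    (hδ : δ' ≤ δ) (hF : ∀ y y', F y y' ≤ F' y y') (hF0 : ∀ y y', 0 ≤ F y y') : IneqL2F K B₀' δ' P F' U := by
  intro n lam hc y y' hy hy' hcut hs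
  have h0 := h n lam hc y y' hy hy' hcut hs
  rw [mul_assoc B₀] at h0
  rw [mul_assoc B₀']
  exact mono5 h0 hB hB' (mul_nonneg (B9FromB6.pref6_nonneg (S.len_nonneg y) n) (S.cutSup_nonneg hc)) hδ (S.dist_nonneg y y')
    (hF y y') (hF0 y y') (S.l2Norm_nonneg lam)

/-- **Weakening the Hölder block with factor** (constant functions up and nonnegative, rate down, factor up).
[cite: Balaban1985BackgroundPropagators, Thm 3.14 proof p.427 (bookkeeping)] -/
theorem ineqHolderF_weaken (S : ModelSignsOn g Ps) {Bβ Bβ' Bε Bε' : ℝ → ℝ} {Bεβ Bεβ' : ℝ → ℝ → ℝ} {δ δ' : ℝ}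
    (h : IneqHolderF K Bβ Bε Bεβ δ P F U) (hβ : ∀ β, Bβ β ≤ Bβ' β) (hβ' : ∀ β, 0 ≤ Bβ' β) (hε : ∀ ε, Bε ε ≤ Bε' ε)
    (hε' : ∀ ε, 0 ≤ Bε' ε) (hεβ : ∀ ε β, Bεβ ε β ≤ Bεβ' ε β) (hεβ' : ∀ ε β, 0 ≤ Bεβ' ε β) (hδ : δ' ≤ δ)
    (hF : ∀ y y', F y y' ≤ F' y y') (hF0 : ∀ y y', 0 ≤ F y y') : IneqHolderF K Bβ' Bε' Bεβ' δ' P F' U := by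
  have hhs (ε : ℝ) (lam : g.Loc) : 0 ≤ g.holder ε lam + g.supNorm lam := add_nonneg (S.holder_nonneg ε lam) (S.supNorm_nonneg lam)
  refine ⟨fun β lam ζ y y' hβ0 hβ1 hy hy' hcut hs => ?_, fun ε lam y y' hε0 hε1 hy hy' hs => ?_,
    fun ε β lam ζ y y' hε0 hε1 hβ0 hβ1 hy hy' hcut hs => ?_⟩
  · have h0 := h.1 β lam ζ y y' hβ0 hβ1 hy hy' hcut hs
    rw [mul_assoc (Bβ β)] at h0
    rw [mul_assoc (Bβ' β)]
    exact mono5 h0 (hβ β) (hβ' β) (mul_nonneg (Real.rpow_nonneg (S.len_nonneg y) _) (S.cutH_nonneg β ζ)) hδ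
      (S.dist_nonneg y y') (hF y y') (hF0 y y') (S.supNorm_nonneg lam)
  · have h0 := h.2.1 ε lam y y' hε0 hε1 hy hy' hs
    rw [← mul_one (Bε ε)] at h0
    have := mono5 h0 (hε ε) (hε' ε) zero_le_one hδ (S.dist_nonneg y y') (hF y y') (hF0 y y') (hhs ε lam)
    rwa [mul_one] at this
  · have h0 := h.2.2 ε β lam ζ y y' hε0 hε1 hβ0 hβ1 hy hy' hcut hs
    rw [mul_assoc (Bεβ ε β)] at h0
    rw [mul_assoc (Bεβ' ε β)]
    exact mono5 h0 (hεβ ε β) (hεβ' ε β) (mul_nonneg (Real.rpow_nonneg (S.len_nonneg y) _) (S.cutH_nonneg β ζ)) hδ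
      (S.dist_nonneg y y') (hF y y') (hF0 y y') (hhs (β + ε) lam)

end Weaken

/-! ## §3 Rows 23 and 22: the whole leaves from the leaves of the printed proof -/

section Assembly

variable {I : Type} {c35 : ℝ} {geo : I → Geometry} {bg : I → Backgrounds} {Kdiff : ∀ i, KernelFamily (geo i) (bg i)}
  {OmK : ∀ i, (geo i).Site → Prop} {dOmega : ∀ i, (geo i).Site → (geo i).Site → ℝ}
  {Ediff : ∀ i, RWExpansion (geo i) (bg i)} {termK : ∀ i, (Ediff i).Walk → KernelFamily (geo i) (bg i)}
  {Ps : ∀ i, (geo i).Loc → Prop}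

/-- Merging rates: e^{−at} ≤ e^{−δt} for δ ≤ a, t ≥ 0. [folklore] -/
private theorem exp_rate_le {a δ t : ℝ} (h : δ ≤ a) (ht : 0 ≤ t) : Real.exp (-(a * t)) ≤ Real.exp (-(δ * t)) :=
  Real.exp_le_exp.2 (neg_le_neg (mul_le_mul_of_nonneg_right h ht))

/-- ★ **THEOREM 3.14, LOCAL READING, AS THE WHOLE PRINTED LEAF `B9Thm314.Thm314LocalPrinted`** (ROW 23; pp. 426–427: *"their difference
satisfies all the inequalities characteristic for operators of the considered type, with the additional factor exp(−δ₀d(y, y′, Ω))"* for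
y, y′ ∈ Ω^{(k)}) FROM THE LEAVES OF THE PRINTED PROOF: the all-norms cancellation leaf, the geometry of (3.93)/(3.154) (`LocData`, `Laws`),
the two summation-with-factor leaves on the restriction `OmK`, the model signs and d(·,·,Ω) ≥ 0 — UNDER THE M-UNIFORM DIAMETER BOUND `hr`
(every localisation domain meeting Ωᶜ within |·|-distance r₀ of Ωᶜ ∩ T^{(k)}, r₀ independent of M: DISPLAYED, and FALSE for Sect. C's
domains — typed-leaf flag T314 part (ii), GAPS G-B9-19, exactly as `B9Thm314.thm314Printed_of_leaves`).  Constants: M₅ = max(M₂, M₃, M₄),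
δ = min(δ₁, δ₂, ¼δ₀), a₀, B₀ = Ce^{½δ₀r₀}B₁, B₀(β) = B₀(β)e^{½δ₀r₀}B₂, B′₀(ε) = B′₀(ε)e^{½δ₀r₀}B₂, B′₀(ε,β) = B′₀(ε,β)e^{½δ₀r₀}B₂.  Nothing of
print asserted; NOT a node discharge. [cite: Balaban1985BackgroundPropagators, Thm 3.14 (3.154) pp.426–427] -/
theorem thm314LocalPrinted_of_leaves (D : ∀ i, LocData (geo i) (bg i) (Ediff i)) (L : ∀ i, (D i).Laws (dOmega i)) (r₀ : ℝ)
    (hr : ∀ i, (D i).diam ≤ r₀) (S : ∀ i, ModelSignsOn (geo i) (Ps i)) (hdΩ : ∀ (i : I) (y y' : (geo i).Site), 0 ≤ dOmega i y y')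
    (hA : DiffExpansionAllNorms c35 geo bg Ediff termK (fun i => (D i).Touches))
    (hS : RWSumFactorYieldsSupL2 geo bg Ediff termK Kdiff OmK) (hH : RWSumFactorYieldsHolder geo bg Ediff termK Kdiff OmK) :
    Thm314LocalPrinted c35 geo bg Kdiff OmK dOmega := by
  obtain ⟨M₂, a₀, δ₀, C, c, Bβ, Bε, Bεβ, hM₂, ha₀, hδ₀, hC, hc, hBβ, hBε, hBεβ, HA⟩ := hA
  obtain ⟨M₃, B₁, δ₁, hM₃, hB₁, hδ₁, HS⟩ := hS c 1 (δ₀ / 2) hc one_pos (half_pos hδ₀)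
  obtain ⟨M₄, B₂, δ₂, hM₄, hB₂, hδ₂, HH⟩ := hH c 1 (δ₀ / 2) hc one_pos (half_pos hδ₀)
  have hex : 0 < Real.exp (δ₀ / 2 * r₀) := Real.exp_pos _
  refine ⟨max M₂ (max M₃ M₄), min (min δ₁ δ₂) (δ₀ / 2 / 2), a₀, C * Real.exp (δ₀ / 2 * r₀) * B₁,
    fun β => Bβ β * Real.exp (δ₀ / 2 * r₀) * B₂, fun ε => Bε ε * Real.exp (δ₀ / 2 * r₀) * B₂,
    fun ε β => Bεβ ε β * Real.exp (δ₀ / 2 * r₀) * B₂, lt_max_of_lt_left hM₂,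
    lt_min (lt_min hδ₁ hδ₂) (by positivity), ha₀, by positivity, fun i hMi α₀ hα hMa U hU => ?_⟩
  have hM2i : M₂ ≤ (geo i).M := le_trans (le_max_left _ _) hMi
  have hM3i : M₃ ≤ (geo i).M := le_trans (le_trans (le_max_left _ _) (le_max_right _ _)) hMi
  have hM4i : M₄ ≤ (geo i).M := le_trans (le_trans (le_max_right _ _) (le_max_right _ _)) hMi
  have hMpos : 0 < (geo i).M := lt_of_lt_of_le hM₂ hM2i
  obtain ⟨hconv, htouch, h42, h43⟩ := HA i hM2i α₀ hα hMa U hU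
  have F0 : ∀ y y' : (geo i).Site, 0 ≤ Real.exp (-(δ₀ / 2 / 2 * dOmega i y y')) := fun _ _ => (Real.exp_pos _).le
  have Fle : ∀ y y' : (geo i).Site, Real.exp (-(δ₀ / 2 / 2 * dOmega i y y')) ≤
      Real.exp (-(min (min δ₁ δ₂) (δ₀ / 2 / 2) * dOmega i y y')) := fun y y' => exp_rate_le (min_le_right _ _) (hdΩ i y y')
  obtain ⟨h1, h2⟩ := HS i hM3i U (C * Real.exp (δ₀ / 2 * r₀)) _ (by positivity) F0 hconv
    (termSupL2F_of_termIneq (D i) (L i) (hr i) (S i) hC.le hc.le hMpos hδ₀.le htouch h42 (OmK i))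
  have h3 := HH i hM4i U _ _ _ _ (fun β => mul_nonneg (hBβ β) hex.le) (fun ε => mul_nonneg (hBε ε) hex.le)
    (fun ε β => mul_nonneg (hBεβ ε β) hex.le) F0 hconv
    (termHolderF_of_termIneq (D i) (L i) (hr i) (S i) hBβ hBε hBεβ hc.le hMpos hδ₀.le htouch h43 (OmK i))
  have hδ1 : min (min δ₁ δ₂) (δ₀ / 2 / 2) ≤ δ₁ := le_trans (min_le_left _ _) (min_le_left _ _)
  have hδ2 : min (min δ₁ δ₂) (δ₀ / 2 / 2) ≤ δ₂ := le_trans (min_le_left _ _) (min_le_right _ _)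
  refine ⟨ineqSupF_weaken (S i) h1 le_rfl (by positivity) hδ1 Fle F0, ineqL2F_weaken (S i) h2 le_rfl (by positivity) hδ1 Fle F0,
    ineqHolderF_weaken (S i) h3 (fun β => le_rfl) (fun β => ?_) (fun ε => le_rfl) (fun ε => ?_) (fun ε β => le_rfl)
      (fun ε β => ?_) hδ2 Fle F0⟩
  · exact mul_nonneg (mul_nonneg (hBβ β) hex.le) hB₂.le
  · exact mul_nonneg (mul_nonneg (hBε ε) hex.le) hB₂.le
  · exact mul_nonneg (mul_nonneg (hBεβ ε β) hex.le) hB₂.le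

/-- **The sup part of Theorem 3.14 on a restriction `P` from the all-norms cancellation leaf and the sup/L² summation leaf** (the Hölder
leaf is not needed; same constants as the sup block of `thm314LocalPrinted_of_leaves`). [cite: Balaban1985BackgroundPropagators, Thm 3.14 (3.154) pp.426–427] -/
theorem thm314SupOn_of_leaves {P : ∀ i, (geo i).Site → Prop} (D : ∀ i, LocData (geo i) (bg i) (Ediff i))
    (L : ∀ i, (D i).Laws (dOmega i)) (r₀ : ℝ) (hr : ∀ i, (D i).diam ≤ r₀) (S : ∀ i, ModelSignsOn (geo i) (Ps i))
    (hdΩ : ∀ (i : I) (y y' : (geo i).Site), 0 ≤ dOmega i y y')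
    (hA : DiffExpansionAllNorms c35 geo bg Ediff termK (fun i => (D i).Touches))
    (hS : RWSumFactorYieldsSupL2 geo bg Ediff termK Kdiff P) : Thm314SupOn c35 geo bg Kdiff P dOmega := by
  obtain ⟨M₂, a₀, δ₀, C, c, Bβ, Bε, Bεβ, hM₂, ha₀, hδ₀, hC, hc, -, -, -, HA⟩ := hA
  obtain ⟨M₃, B₁, δ₁, hM₃, hB₁, hδ₁, HS⟩ := hS c 1 (δ₀ / 2) hc one_pos (half_pos hδ₀)
  refine ⟨max M₂ M₃, min δ₁ (δ₀ / 2 / 2), a₀, C * Real.exp (δ₀ / 2 * r₀) * B₁, lt_max_of_lt_left hM₂,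
    lt_min hδ₁ (by positivity), ha₀, by positivity, fun i hMi α₀ hα hMa U hU => ?_⟩
  have hM2i : M₂ ≤ (geo i).M := le_trans (le_max_left _ _) hMi
  have hMpos : 0 < (geo i).M := lt_of_lt_of_le hM₂ hM2i
  obtain ⟨hconv, htouch, h42, -⟩ := HA i hM2i α₀ hα hMa U hU
  have F0 : ∀ y y' : (geo i).Site, 0 ≤ Real.exp (-(δ₀ / 2 / 2 * dOmega i y y')) := fun _ _ => (Real.exp_pos _).le
  obtain ⟨h1, -⟩ := HS i (le_trans (le_max_right _ _) hMi) U (C * Real.exp (δ₀ / 2 * r₀)) _ (by positivity) F0 hconv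
    (termSupL2F_of_termIneq (D i) (L i) (hr i) (S i) hC.le hc.le hMpos hδ₀.le htouch h42 (P i))
  exact ineqSupF_weaken (S i) h1 le_rfl (by positivity) (min_le_left _ _)
    (fun y y' => exp_rate_le (min_le_right _ _) (hdΩ i y y')) F0

/-- ★ **THEOREM 3.14 AS THE LEAF FIELD `B9.Thm314Printed`** (ROW 22: sup entries, NO localisation restriction) FROM THE SAME LEAVES with the
sup/L² summation leaf unrestricted (`fun _ _ => True`): on the random-walk route the restriction «y, y′ ∈ Ω^{(k)}» is idle, so row 22 needs
neither the plain bound (β) nor the geometric comparison (γ) of `B9Thm314Unrestricted` (that route remains the alternative).  Flag T314 (ii)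
displayed as `hr`, as above. [cite: Balaban1985BackgroundPropagators, Thm 3.14 (3.154) pp.426–427] -/
theorem thm314Printed_of_leaves_allNorms (D : ∀ i, LocData (geo i) (bg i) (Ediff i)) (L : ∀ i, (D i).Laws (dOmega i)) (r₀ : ℝ)
    (hr : ∀ i, (D i).diam ≤ r₀) (S : ∀ i, ModelSignsOn (geo i) (Ps i)) (hdΩ : ∀ (i : I) (y y' : (geo i).Site), 0 ≤ dOmega i y y')
    (hA : DiffExpansionAllNorms c35 geo bg Ediff termK (fun i => (D i).Touches))
    (hS : RWSumFactorYieldsSupL2 geo bg Ediff termK Kdiff (fun _ _ => True)) : Thm314Printed c35 geo bg Kdiff dOmega :=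
  thm314Printed_iff_supOn_univ.2 (thm314SupOn_of_leaves D L r₀ hr S hdΩ hA hS)

/-- **Both leaf fields of the certificate at once** (`t314` and `t314loc`) from the leaves: the unrestricted sup/L² summation leaf for
row 22, the restricted sup/L² and Hölder summation leaves for row 23. [cite: Balaban1985BackgroundPropagators, Thm 3.14 (3.154) pp.426–427] -/
theorem thm314_pair_of_leaves (D : ∀ i, LocData (geo i) (bg i) (Ediff i)) (L : ∀ i, (D i).Laws (dOmega i)) (r₀ : ℝ)
    (hr : ∀ i, (D i).diam ≤ r₀) (S : ∀ i, ModelSignsOn (geo i) (Ps i)) (hdΩ : ∀ (i : I) (y y' : (geo i).Site), 0 ≤ dOmega i y y')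
    (hA : DiffExpansionAllNorms c35 geo bg Ediff termK (fun i => (D i).Touches))
    (hSu : RWSumFactorYieldsSupL2 geo bg Ediff termK Kdiff (fun _ _ => True))
    (hS : RWSumFactorYieldsSupL2 geo bg Ediff termK Kdiff OmK) (hH : RWSumFactorYieldsHolder geo bg Ediff termK Kdiff OmK) :
    Thm314Printed c35 geo bg Kdiff dOmega ∧ Thm314LocalPrinted c35 geo bg Kdiff OmK dOmega :=
  ⟨thm314Printed_of_leaves_allNorms D L r₀ hr S hdΩ hA hSu, thm314LocalPrinted_of_leaves D L r₀ hr S hdΩ hA hS hH⟩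

end Assembly

end Literature.MathematicalPhysics.QuantumFieldTheory.Balaban1983to89.B9Thm314Whole
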